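import Summits.MatrixMultiplication.OmegaCensus.SmallFormats.RankOnePlaneCap
import HarnessLib

/-!
# ω-census family (a): the rank-one plane cap for the COLUMN planes `{z λᵀ}` of `⟨2,2,n⟩`

Cell `pub-omega` (unit `pub-omega-lit`, gen 5), topic `Summits/MatrixMultiplication/OmegaCensus`
(sub-folder `SmallFormats`). Framing (verbatim): lottery ticket; floor = certified bounds/negative
ranges. HONEST FRAMING: the transpose-dual companion of `RankOnePlaneCap.card_vanishing_add_lt`
(our elementary lemma); a cap for structured searches, not a rank bound, not progress on `ω`.

From a bilinear computation `XY = ∑ f_i(X) g_i(Y) w_i` of `⟨2,2,n⟩` one gets the computation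
`XY = ∑ f_i(Xᵀ) ⟨w_i, Y⟩ G_i` of the same map (`G_i` the coefficient matrix of `g_i`, `⟨·,·⟩` the
entrywise pairing) — the symmetry `(X, Y, Z) ↦ (Xᵀ, Zᵀ, Yᵀ)` of the matrix multiplication tensor.
Its X-forms are the transposes, so the row-plane cap for it is the column-plane cap for the original:
with `r = |ι| < 4n` and `λ ≠ 0`, at most `r − 2n − 1` X-forms vanish on `{z λᵀ : z ∈ k²}` (all
`2 × 2` matrices whose rows are multiples of `λᵀ`). Over `𝔽₃`, `n = 5`, `r = 17`: `≤ 6` on each of the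
4 column planes (substitution: 7).
-/

namespace Summit.MatrixMultiplication.OmegaCensus.RankOnePlaneCap

open Module Matrix Literature.Computability.AlgebraicComplexity

variable {k : Type*} [Field k] {n : ℕ} {ι : Type*} [Fintype ι]

/-- **Transpose-dual computation.** From `β` computing `XY` build the computation with X-forms
`X ↦ f_i(Xᵀ)`, Y-forms `Y ↦ ∑ w_i κ ν · Y κ ν` and outputs `G_i κ ν = g_i(E_{κν})`. -/
theorem exists_transposeDual (β : BilinComp (mulBilin k 2 2 n) ι) :
    ∃ β' : BilinComp (mulBilin k 2 2 n) ι, ∀ i X, β'.f i X = β.f i Xᵀ := by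
  classical
  refine ⟨{ f := fun i =>
              { toFun := fun X => β.f i Xᵀ
                map_add' := fun X X' => by rw [Matrix.transpose_add, map_add]
                map_smul' := fun c X => by rw [Matrix.transpose_smul, map_smul]; rfl }
            g := fun i =>
              { toFun := fun Y => ∑ κ, ∑ ν, β.w i κ ν * Y κ ν
                map_add' := fun Y Y' => by
                  simp only [Matrix.add_apply, mul_add, Finset.sum_add_distrib]
                map_smul' := fun c Y => by
                  simp only [Matrix.smul_apply, smul_eq_mul, RingHom.id_apply, Finset.mul_sum]
                  exact Finset.sum_congr rfl fun κ _ => Finset.sum_congr rfl fun ν _ => by ring }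
            w := fun i => Matrix.of fun κ ν => β.g i (Matrix.single κ ν (1 : k))
            map_eq_sum := ?_ }, fun i X => rfl⟩
  intro X Y
  rw [mulBilin_apply]
  ext a b
  have hβ : ∀ κ ν, (∑ i, (β.f i Xᵀ * β.g i (Matrix.single a b (1 : k))) * β.w i κ ν)
      = if ν = b then X a κ else 0 := by
    intro κ ν
    have h := β.map_eq_sum Xᵀ (Matrix.single a b (1 : k))
    rw [mulBilin_apply] at h
    have h2 := congrFun (congrFun h κ) ν
    rw [mul_single_apply', Matrix.transpose_apply] at h2
    rw [h2, Matrix.sum_apply]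
    exact Finset.sum_congr rfl fun i _ => by simp
  simp only [LinearMap.coe_mk, AddHom.coe_mk, Matrix.sum_apply, Matrix.smul_apply, Matrix.of_apply,
    smul_eq_mul]
  calc (X * Y) a b = ∑ κ, X a κ * Y κ b := Matrix.mul_apply
    _ = ∑ κ, ∑ ν, Y κ ν * (if ν = b then X a κ else 0) := by
        refine Finset.sum_congr rfl fun κ _ => ?_
        simp [mul_comm]
    _ = ∑ κ, ∑ ν, Y κ ν * ∑ i, (β.f i Xᵀ * β.g i (Matrix.single a b (1 : k))) * β.w i κ ν := by
        simp_rw [hβ]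
    _ = ∑ κ, ∑ ν, ∑ i, Y κ ν * ((β.f i Xᵀ * β.g i (Matrix.single a b (1 : k))) * β.w i κ ν) := by
        simp_rw [Finset.mul_sum]
    _ = ∑ κ, ∑ i, ∑ ν, Y κ ν * ((β.f i Xᵀ * β.g i (Matrix.single a b (1 : k))) * β.w i κ ν) :=
        Finset.sum_congr rfl fun κ _ => Finset.sum_comm
    _ = ∑ i, ∑ κ, ∑ ν, Y κ ν * ((β.f i Xᵀ * β.g i (Matrix.single a b (1 : k))) * β.w i κ ν) :=
        Finset.sum_comm
    _ = ∑ i, (β.f i Xᵀ * ∑ κ, ∑ ν, β.w i κ ν * Y κ ν) * β.g i (Matrix.single a b (1 : k)) := by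
        refine Finset.sum_congr rfl fun i _ => ?_
        rw [Finset.mul_sum, Finset.sum_mul]
        refine Finset.sum_congr rfl fun κ _ => ?_
        rw [Finset.mul_sum, Finset.sum_mul]
        exact Finset.sum_congr rfl fun ν _ => by ring

/-- **Column-plane cap.** In a bilinear computation of `⟨2,2,n⟩` of length `< 4n`, a set `R` of indices
whose X-forms vanish on `{z λᵀ : z}` (`λ ≠ 0`) has `|R| + 2n + 1 ≤ |ι|`. -/
theorem card_vanishing_col_add_lt (hn4 : Fintype.card ι < 4 * n)
    (β : BilinComp (mulBilin k 2 2 n) ι) {lam : Fin 2 → k} (hlam : lam ≠ 0) (R : Finset ι)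
    (hR : ∀ i ∈ R, ∀ z : Fin 2 → k, β.f i (vecMulVec z lam) = 0) :
    R.card + 2 * n + 1 ≤ Fintype.card ι := by
  obtain ⟨β', hβ'⟩ := exists_transposeDual β
  refine card_vanishing_add_lt hn4 β' hlam R fun i hi z => ?_
  rw [hβ', Matrix.transpose_vecMulVec]
  exact hR i hi z

/-- Coordinate form (`λ = e_μ₀`): the X-forms that vanish on every matrix supported on column `μ₀`
(`vecMulVec z (Pi.single μ₀ 1)`), i.e. that do NOT read column `μ₀` of `X` — for `2 × 2` matrices: that
read only the other column. At most `r − 2n − 1` of them when `r < 4n`. -/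
theorem card_notReadingCol_add_lt (hn4 : Fintype.card ι < 4 * n)
    (β : BilinComp (mulBilin k 2 2 n) ι) (μ₀ : Fin 2) (R : Finset ι)
    (hR : ∀ i ∈ R, ∀ z : Fin 2 → k, β.f i (vecMulVec z (Pi.single μ₀ 1)) = 0) :
    R.card + 2 * n + 1 ≤ Fintype.card ι :=
  card_vanishing_col_add_lt hn4 β (lam := Pi.single μ₀ 1)
    (by
      intro h
      have := congrFun h μ₀
      simp at this) R hR

/-- Same statement as `card_notReadingCol_add_lt` under its first (misleading) name: the hypothesis
says the forms VANISH on the matrices supported on column `μ₀` (they do not read column `μ₀`). Kept for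
append-only compatibility. -/
@[deprecated card_notReadingCol_add_lt (since := "2026-08-21")]
theorem card_readsOnlyCol_add_lt (hn4 : Fintype.card ι < 4 * n)
    (β : BilinComp (mulBilin k 2 2 n) ι) (μ₀ : Fin 2) (R : Finset ι)
    (hR : ∀ i ∈ R, ∀ z : Fin 2 → k, β.f i (vecMulVec z (Pi.single μ₀ 1)) = 0) :
    R.card + 2 * n + 1 ≤ Fintype.card ι :=
  card_notReadingCol_add_lt hn4 β μ₀ R hR

/-- **Census instance `⟨2,2,5⟩ @ 17`, column planes**: at most `6` X-forms vanish on a plane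
`{z λᵀ}` in a 17-term algorithm (substitution alone: `7`). -/
theorem card_vanishing_col_le_six_225 {ι : Type*} [Fintype ι] (h17 : Fintype.card ι = 17)
    (β : BilinComp (mulBilin k 2 2 5) ι) {lam : Fin 2 → k} (hlam : lam ≠ 0) (R : Finset ι)
    (hR : ∀ i ∈ R, ∀ z : Fin 2 → k, β.f i (vecMulVec z lam) = 0) : R.card ≤ 6 := by
  have := card_vanishing_col_add_lt (by omega) β hlam R hR
  omega

end Summit.MatrixMultiplication.OmegaCensus.RankOnePlaneCap
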